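import Literature.LinearAlgebra.Matrix.CentralizerTraceFormNondegenerate     -- ★ p850543: `eq_zero_of_forall_trace_mul_centralizer_eq_zero`, `…_centralizer_mul_…`
import Mathlib.LinearAlgebra.BilinearForm.Properties
import HarnessLib

/-!
# Dual expansion in the centralizer of a semisimple matrix: `y = ∑ᵢ tr(bᵢ y) · cᵢ` (characteristic `0`)

Topic `LinearAlgebra/Matrix`; namespace `Literature.LinearAlgebra.Matrix`.  THEOREMS ONLY (no `def`, no instance, no notation, no named fact, no `sorry`).  Cell
`pub/hodgecm-mathlib` (crux H413 = `stmt-HodgeConjecture-24833`, `--supports` only), LH5b «TAMAGAWA-DENSITY» organ J0 «NONDEG» (holder F0P3-p04 (g15)): the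
BOUNDED-DENOMINATOR step of «`Λ₁(x)#` is compact» reads every `Y ∈ 𝔷(x)_w` off finitely many trace pairings `tr(bᵢ Y)` against a basis of the commutant.

THE STATEMENT.  For a semisimple `u ∈ M_n(K)`, `char K = 0`, and ANY `K`-basis `b` of the centralizer algebra `Z(u)` there is a DUAL family `c : ι → Z(u)` with
`y = ∑ᵢ tr(bᵢ y) · cᵢ` for every `y ∈ Z(u)` — the dual basis for the trace pairing, which is NON-DEGENERATE on `Z(u)` (★ `CentralizerTraceFormNondegenerate`:
`Z(u)` is a semisimple ring [ArthurClozelAMS120, Ch. 1 §1 p. 4], and its trace-radical is a nil ideal [HornJohnson2013, 2.4.P10]).  Also packaged: the trace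
pairing on `Z(u)` as a Mathlib `LinearMap.BilinForm` statement of non-degeneracy (`traceForm_centralizer_nondegenerate`, stated on the bilinear map built inline).

HONEST LABEL: count-neutral infrastructure; HC_CM is proved only modulo the printed citations until rung 0 closes.

## References
* [ArthurClozelAMS120] J. Arthur, L. Clozel, Ann. of Math. Stud. 120 (1989), Ch. 1 §1 p. 4.
* [HornJohnson2013] R. A. Horn, C. R. Johnson, *Matrix Analysis*, 2nd ed. (2013), 2.4.P10 p. 171; 0.6 (dual bases).
-/

set_option autoImplicit false

namespace Literature.LinearAlgebra.Matrix

section DualExpansion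

variable {K : Type*} [Field K] [CharZero K] {n : Type*} [Fintype n] [DecidableEq n]

/-- **The trace pairing on `Z(u)` is a non-degenerate bilinear form** (`u` semisimple, `char K = 0`): the inline `LinearMap.BilinForm` `(x, y) ↦ tr(x y)` on the
`K`-module `↥Z(u)` is `Nondegenerate` (left- AND right-separating). [cite: ArthurClozelAMS120, Ch. 1 §1 p. 4] [cite: HornJohnson2013, 2.4.P10 p. 171] -/
theorem traceForm_centralizer_nondegenerate (u : Matrix n n K) (hu : Module.End.IsSemisimple (Matrix.toLin' u)) :
    (LinearMap.mk₂ K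
        (fun x y : Subalgebra.centralizer K ({u} : Set (Matrix n n K)) => ((x : Matrix n n K) * (y : Matrix n n K)).trace)
        (fun x x' y => by rw [Subalgebra.coe_add, Matrix.add_mul, Matrix.trace_add])
        (fun a x y => by rw [Subalgebra.coe_smul, Matrix.smul_mul, Matrix.trace_smul, smul_eq_mul])
        (fun x y y' => by rw [Subalgebra.coe_add, Matrix.mul_add, Matrix.trace_add])
        (fun a x y => by rw [Subalgebra.coe_smul, Matrix.mul_smul, Matrix.trace_smul, smul_eq_mul]) :
      LinearMap.BilinForm K (Subalgebra.centralizer K ({u} : Set (Matrix n n K)))).Nondegenerate := by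
  refine ⟨?_, ?_⟩
  · intro x hx
    refine Subtype.ext (eq_zero_of_forall_trace_mul_centralizer_eq_zero u hu x.2 fun b hb => ?_)
    have h := hx ⟨b, hb⟩
    rwa [LinearMap.mk₂_apply] at h
  · intro y hy
    refine Subtype.ext (eq_zero_of_forall_trace_centralizer_mul_eq_zero u hu y.2 fun b hb => ?_)
    have h := hy ⟨b, hb⟩
    rwa [LinearMap.mk₂_apply] at h

/-- **Dual expansion in `Z(u)`**: for `u` semisimple (`char K = 0`) and any `K`-basis `b` of the centralizer algebra `Z(u)` there is a dual family `c` in `Z(u)` with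
`y = ∑ᵢ tr(bᵢ · y) • cᵢ` for every `y ∈ Z(u)` (the dual basis of `b` for the non-degenerate trace pairing). [cite: HornJohnson2013, 0.6 and 2.4.P10 p. 171]
[cite: ArthurClozelAMS120, Ch. 1 §1 p. 4] -/
theorem exists_dual_family_trace_expansion (u : Matrix n n K) (hu : Module.End.IsSemisimple (Matrix.toLin' u))
    {ι : Type*} [Fintype ι] [DecidableEq ι] (b : Module.Basis ι K (Subalgebra.centralizer K ({u} : Set (Matrix n n K)))) :
    ∃ c : ι → Matrix n n K, (∀ i, c i ∈ Subalgebra.centralizer K ({u} : Set (Matrix n n K))) ∧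
      ∀ y ∈ Subalgebra.centralizer K ({u} : Set (Matrix n n K)), y = ∑ i, ((b i : Matrix n n K) * y).trace • c i := by
  set B : LinearMap.BilinForm K (Subalgebra.centralizer K ({u} : Set (Matrix n n K))) := LinearMap.mk₂ K
        (fun x y : Subalgebra.centralizer K ({u} : Set (Matrix n n K)) => ((x : Matrix n n K) * (y : Matrix n n K)).trace)
        (fun x x' y => by rw [Subalgebra.coe_add, Matrix.add_mul, Matrix.trace_add])
        (fun a x y => by rw [Subalgebra.coe_smul, Matrix.smul_mul, Matrix.trace_smul, smul_eq_mul])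
        (fun x y y' => by rw [Subalgebra.coe_add, Matrix.mul_add, Matrix.trace_add])
        (fun a x y => by rw [Subalgebra.coe_smul, Matrix.mul_smul, Matrix.trace_smul, smul_eq_mul]) with hB
  have hBapply : ∀ x y : Subalgebra.centralizer K ({u} : Set (Matrix n n K)), B x y = ((x : Matrix n n K) * (y : Matrix n n K)).trace := fun x y => by rw [hB, LinearMap.mk₂_apply]
  have hBnd : B.Nondegenerate := by rw [hB]; exact traceForm_centralizer_nondegenerate u hu
  refine ⟨fun i => ((B.dualBasis hBnd b i : Subalgebra.centralizer K ({u} : Set (Matrix n n K))) : Matrix n n K), fun i => (B.dualBasis hBnd b i).2, fun y hy => ?_⟩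
  have hsum := (B.dualBasis hBnd b).sum_repr ⟨y, hy⟩
  have hco : ((∑ i, (B.dualBasis hBnd b).repr ⟨y, hy⟩ i • B.dualBasis hBnd b i : Subalgebra.centralizer K ({u} : Set (Matrix n n K))) : Matrix n n K) =
      ∑ i, ((b i : Matrix n n K) * y).trace • ((B.dualBasis hBnd b i : Subalgebra.centralizer K ({u} : Set (Matrix n n K))) : Matrix n n K) := by
    rw [AddSubmonoidClass.coe_finsetSum]
    refine Finset.sum_congr rfl fun i _ => ?_
    rw [Subalgebra.coe_smul, LinearMap.BilinForm.dualBasis_repr_apply, hBapply, Matrix.trace_mul_comm]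
  beta_reduce
  rw [← hco, hsum]

/-- **Dual expansion, coordinate-free existence form**: for `u` semisimple (`char K = 0`) there are finitely many `b₁ … b_d, c₁ … c_d ∈ Z(u)` with `y = ∑ᵢ tr(bᵢ y) • cᵢ` on
`Z(u)`; the `bᵢ` may be taken from ANY `K`-basis of `Z(u)` (previous theorem) — here from `Module.finBasis`. [cite: HornJohnson2013, 0.6 and 2.4.P10 p. 171] -/
theorem exists_finite_dual_families_trace_expansion (u : Matrix n n K) (hu : Module.End.IsSemisimple (Matrix.toLin' u)) :
    ∃ (d : ℕ) (b c : Fin d → Matrix n n K), (∀ i, b i ∈ Subalgebra.centralizer K ({u} : Set (Matrix n n K))) ∧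
      (∀ i, c i ∈ Subalgebra.centralizer K ({u} : Set (Matrix n n K))) ∧
      ∀ y ∈ Subalgebra.centralizer K ({u} : Set (Matrix n n K)), y = ∑ i, (b i * y).trace • c i := by
  haveI : FiniteDimensional K (Subalgebra.centralizer K ({u} : Set (Matrix n n K))) :=
    FiniteDimensional.finiteDimensional_submodule (Subalgebra.toSubmodule (Subalgebra.centralizer K ({u} : Set (Matrix n n K))))
  let bC := Module.finBasis K (Subalgebra.centralizer K ({u} : Set (Matrix n n K)))
  obtain ⟨c, hc, hexp⟩ := exists_dual_family_trace_expansion u hu bC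
  exact ⟨Module.finrank K (Subalgebra.centralizer K ({u} : Set (Matrix n n K))), fun i => (bC i : Matrix n n K), c, fun i => (bC i).2, hc, hexp⟩

end DualExpansion

end Literature.LinearAlgebra.Matrix
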